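import Literature.AlgebraicGeometry.HodgeTheory.HodgeSectionRestrictionProofs
import Literature.AlgebraicGeometry.HodgeTheory.SupportedHodgeClassesAlgebraic
import Literature.AlgebraicGeometry.HodgeTheory.GysinKernelProofs
import Literature.AlgebraicGeometry.HodgeTheory.HodgeIndexSurface
import Literature.AlgebraicGeometry.Motives.ComplexPointsOrientation
import HarnessLib

/-!
# Hodge classes restrict non-trivially to hypersurface sections: "`ζ ∪ [Zᵢ] ≠ 0`, equivalently `ζ|_{Zᵢ} ≠ 0`" through Deligne's Gysin-kernel theorem and the projection formula (proved reduction, no tautness)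

Family `hodge`, layer `Literature/AlgebraicGeometry/HodgeTheory`. Third companion of the named
fact `hodgeSectionRestriction_of_hodgeConjectureFor` (file `HodgeSectionRestriction`;
P. Brosnan, H. Fang, Z. Nie, G. Pearlstein, *Singularities of admissible normal functions*,
Invent. Math. 177 (2009), §6 Lemma 50 with Lemma 49, arXiv:0711.0964 p. 13). The first
companion (`HodgeSectionRestrictionProofs`) formalised the printed proof and reduced the fact to
(P) the perfect pairing on middle Hodge classes and a topological input — (T) tautness /
(LC) local contractibility of the complex points `Z(ℂ)` of Zariski-closed subsets — needed for
the one step of the printed proof that is not a formality on the tree's carriers: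

> "Since `ζ ∪ α ≠ 0`, `ζ ∪ [Zᵢ] ≠ 0` for some index `i`. Equivalently,
> `0 ≠ ζ|_{Zᵢ} ∈ H^{2n}(Zᵢ, ℚ(n))`."

(the second companion, `HodgeSectionRestrictionTriangulable`, proves (LC) from the semialgebraic
triangulation theorem). This file gives that step its CLASSICAL proof instead, which needs no
point-set regularity of `Zᵢ(ℂ)` at all: `[Zᵢ] = (j̃ᵢ)_* 1` for a desingularisation
`j̃ᵢ : Z̃ᵢ → Zᵢ ⊂ X`, and by the projection formula `ζ ∪ (j̃ᵢ)_* b = (j̃ᵢ)_* (j̃ᵢ^* ζ ∪ b)`, so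
`ζ ∪ (j̃ᵢ)_* b ≠ 0` forces `j̃ᵢ^* ζ ≠ 0`, and `j̃ᵢ(ℂ) : Z̃ᵢ(ℂ) → X(ℂ)` factors through the subspace
`Zᵢ(ℂ)`, whence `ζ|_{Zᵢ(ℂ)} ≠ 0`. On the tree's carriers (`algebraicClasses X n = Nⁿ H^{2n}`, classes
supported on closed subsets of codimension `≥ n`) the identification of the classes supported on
`Z` with Gysin images from resolutions of its components is exactly the conjunction of two NAMED
FACTS ALREADY IN THE TREE, used here as hypotheses (D-0026: nothing new is vendored):

* `hA : Deligne1974_ker_restrictCompl_eq_iSup_range_complexGysin` (`HodgeTheory/GysinKernel`;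
  Deligne, *Théorie de Hodge III*, Cor. 8.2.8): `ker (Hᵇ(X(ℂ)) → Hᵇ((X ∖ ⋃ⱼ gⱼ(Yⱼ))(ℂ))) = Σⱼ im (gⱼ)_*`
  for morphisms `gⱼ : Yⱼ → X` from smooth projective varieties;
* `hH : Resolution.Hironaka1964_projective` (`Resolution/ProjectiveResolution`; Kollár 2007,
  Thm. 3.27): through the tree's PROVED `exists_family_iUnion_range_eq_of_isClosed`
  (`HodgeTheory/SupportedHodgeClassesAlgebraic`), every Zariski-closed `Z ⊆ X` is such a joint
  image `⋃ⱼ gⱼ(Yⱼ)`;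

together with PROVED results of the tree: the projection formula for the real Gysin morphisms
(`complexGysin_cup`, Fulton, *Young Tableaux*, App. B (6)), Poincaré duality for every orientation
family (`OrientationFamily.hasPoincareDuality`), and the existence of orientations of `X(ℂ)`
(`Motives.ComplexPoints.isOrientableOver`).

Results: `map_ne_zero_of_cupProduct_ne_zero_of_gysinKernel` — the support criterion
("`c ∪ a ≠ 0`, `a` supported on the Zariski-closed `Z` ⟹ `c|_{Z(ℂ)} ≠ 0`") from `hA`, `hH`, in
every degree and codimension; `forall_le_exists_sectionRestriction_ne_zero_of_gysinKernel` — the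
geometric half of Lemma 50 (all large degrees) from `hA`, `hH`;
`hodgeSectionRestriction_of_hodgeConjectureFor_of_pairing_of_gysinKernel` — **the named fact from
(P) and the two existing named facts `hA`, `hH`**. And the SURFACE case from named facts of the tree
only, in every large degree: `forall_le_sectionRestriction_surface_of_hodgeIndex_of_gysinKernel`
(`hodgeIndex_surface X` + `lefschetzOneOne_rational`, which give (P) and (H) for `n = 1`, + `hA` + `hH`;
Kerr–Pearlstein 2011, Example 43). With `HodgeSectionRestrictionTriangulable`
this leaves (P) — the non-degeneracy of the cup product on the rational `(n, n)`-classes of a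
smooth projective `2n`-fold ("By Poincaré duality and the Hodge–Riemann bilinear relations"; hard
Lefschetz `nonempty_hardLefschetzNFold` + Lefschetz decomposition over `ℚ` + Hodge–Riemann, for
which the tree has no summit-side carrier) — as the ONLY input of the fact not reduced to named
facts of the tree.

## References

* [BrosnanFangNiePearlstein2009] P. Brosnan, H. Fang, Z. Nie, G. Pearlstein, Singularities of
  admissible normal functions, Invent. Math. 177 (2009) 599–629, §6 Lemma 49, Lemma 50 and proof
  of Thm. 51 (arXiv:0711.0964, p. 13).
* [DeligneHodgeIII1974] P. Deligne, Théorie de Hodge III, Publ. Math. IHÉS 44 (1974), Prop. 8.2.7,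
  Cor. 8.2.8.
* [Kollar2007] J. Kollár, Lectures on Resolution of Singularities (2007), Thm. 3.27.
* [FultonYoungTableaux1997] W. Fulton, Young Tableaux (CUP 1997), App. B §B.1 (5), (6).
* [HatcherAT2002] A. Hatcher, Algebraic Topology (CUP 2002), §3.1, §3.3 Thm. 3.30.
* [KerrPearlstein2011] M. Kerr, G. Pearlstein, An exponential history of functions with
  logarithmic growth, MSRI Publ. 58 (2011), Example 43.
-/

noncomputable section

open CategoryTheory AlgebraicGeometry
open Literature.AlgebraicTopology.SingularHomology

namespace Literature.AlgebraicGeometry.HodgeTheory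

section HodgeTheory

variable {X : Motives.SchemeOver ℂ}

/-- **A morphism into `X` with image in `Z` factors through `Z(ℂ)` on complex points**: if
`g : Y ⟶ X` has `g(Y) ⊆ Z` and `c|_{Z(ℂ)} = 0`, then `g(ℂ)^* c = 0` (functoriality of `Hᵏ`,
Hatcher §3.1; `pt (g(ℂ) P) = g (pt P)`). [cite: HatcherAT2002, §3.1] -/
theorem map_eq_zero_of_range_subset {Y : Motives.SchemeOver ℂ} (g : Y ⟶ X) {Z : Set X.left}
    (hgZ : Set.range g.left.base ⊆ Z) {k : ℕ} {c : complexBetti X k}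
    (hc : singularCohomology.map ℂ ℂ
      (⟨Subtype.val, continuous_subtype_val⟩ :
        C({P : Motives.ComplexPoints X // P.pt ∈ Z}, Motives.ComplexPoints X)) k c = 0) :
    complexBetti.map g k c = 0 := by
  have hfac : Motives.AlgPoints.mapContinuous (L := ℂ) g =
      (⟨Subtype.val, continuous_subtype_val⟩ :
        C({P : Motives.ComplexPoints X // P.pt ∈ Z}, Motives.ComplexPoints X)).comp
        (⟨fun P ↦ ⟨Motives.AlgPoints.mapContinuous (L := ℂ) g P,
            hgZ ⟨P.pt, (Motives.AlgPoints.pt_map g P).symm⟩⟩,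
          (Motives.AlgPoints.mapContinuous (L := ℂ) g).continuous.subtype_mk _⟩ :
          C(Motives.ComplexPoints Y, {P : Motives.ComplexPoints X // P.pt ∈ Z})) :=
    rfl
  change singularCohomology.map ℂ ℂ (Motives.AlgPoints.mapContinuous (L := ℂ) g) k c = 0
  rw [hfac, singularCohomology.map_comp, ModuleCat.comp_apply, hc, map_zero]

/-- **Projection formula, vanishing form**: if `g^* c = 0` then `c ∪ g_* y = g_* (g^* c ∪ y) = 0`
for every `y` (`complexGysin_cup`, Fulton App. B (6) "`f_*(f^*(α) · β) = α · f_*(β)`").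
[cite: FultonYoungTableaux1997, Appendix B §B.1 (6)] -/
theorem cupProduct_complexGysin_eq_zero_of_map_eq_zero {μ : OrientationFamily}
    (hμ : μ.HasPoincareDuality) {N m : ℕ} {Y : Motives.SchemeOver ℂ}
    (hY : Motives.IsSmoothProjective m Y) (hX : Motives.IsSmoothProjective N X) (g : Y ⟶ X)
    {p q q' b : ℕ} (hq : q + 2 * N = q' + 2 * m) (hpq' : p + q' = b) {c : complexBetti X p}
    (hc : complexBetti.map g p c = 0) (y : complexBetti Y q) :
    cupProduct hpq' c (complexGysin μ hY hX g hq y) = 0 := by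
  rw [← complexGysin_cup hμ hY hX g (p := p) (q := q) (a := p + q) rfl
    (show p + q + 2 * N = b + 2 * m by omega) hq hpq' c y, hc, map_zero, LinearMap.zero_apply,
    map_zero]

/-- **"`ζ ∪ [Zᵢ] ≠ 0`, equivalently `0 ≠ ζ|_{Zᵢ}`" through the Gysin kernel** (the support
criterion, classical proof). Let `X` be smooth projective over `ℂ`, `Z ⊆ X` Zariski-closed,
`a ∈ H^q(X(ℂ); ℂ)` supported on `Z` (`a|_{(X ∖ Z)(ℂ)} = 0`) and `c ∪ a ≠ 0`. Then `c|_{Z(ℂ)} ≠ 0`: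
write `Z = ⋃ⱼ gⱼ(Yⱼ)` with `gⱼ : Yⱼ → X` from smooth projective `Yⱼ` (resolutions of the
components, `hH` via `exists_family_iUnion_range_eq_of_isClosed`); by Deligne's Cor. 8.2.8 (`hA`)
`a = Σⱼ (gⱼ)_* yⱼ`, so `c ∪ (gⱼ)_* yⱼ ≠ 0` for some `j`; by the projection formula
`c ∪ (gⱼ)_* yⱼ = (gⱼ)_* (gⱼ^* c ∪ yⱼ)`, hence `gⱼ^* c ≠ 0`; and `gⱼ(ℂ)` factors through `Z(ℂ)`
(`map_eq_zero_of_range_subset`). The orientation family is any choice of orientations of the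
`X(ℂ)` (`Motives.ComplexPoints.isOrientableOver`), which has Poincaré duality
(`OrientationFamily.hasPoincareDuality`). [cite: BrosnanFangNiePearlstein2009, §6 Lemma 50]
[cite: DeligneHodgeIII1974, Cor. 8.2.8] [cite: FultonYoungTableaux1997, Appendix B §B.1 (6)] -/
theorem map_ne_zero_of_cupProduct_ne_zero_of_gysinKernel
    (hA : Deligne1974_ker_restrictCompl_eq_iSup_range_complexGysin)
    (hH : Resolution.Hironaka1964_projective.{0})
    {N : ℕ} (hX : Motives.IsSmoothProjective N X) {Z : Set X.left} (hZ : IsClosed Z)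
    {p q b : ℕ} (h : p + q = b) {c : complexBetti X p} {a : complexBetti X q}
    (ha : complexBetti.restrictCompl X Z q a = 0) (hca : cupProduct h c a ≠ 0) :
    singularCohomology.map ℂ ℂ
      (⟨Subtype.val, continuous_subtype_val⟩ :
        C({P : Motives.ComplexPoints X // P.pt ∈ Z}, Motives.ComplexPoints X)) p c ≠ 0 := by
  classical
  -- an orientation family, with Poincaré duality
  let μ : OrientationFamily := fun _ _ h ↦ Classical.choice (Motives.ComplexPoints.isOrientableOver ℂ h)
  have hμ : μ.HasPoincareDuality := μ.hasPoincareDuality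
  -- `Z = ⋃ⱼ gⱼ(Yⱼ)` (resolutions of the components; codimension `≥ 0` is no condition)
  obtain ⟨ι, _, m, Y, hY, g, hZeq, -⟩ :=
    exists_family_iUnion_range_eq_of_isClosed hH hX hZ (r := 0) (fun _ _ ↦ by simp)
  subst hZeq
  -- `a = Σⱼ (gⱼ)_* yⱼ` (Deligne, Cor. 8.2.8)
  have ha' := Deligne1974_ker_restrictCompl_eq_iSup_range_complexGysin.mem_iSup_range hA μ hμ hX
    hY g ha
  -- some `(gⱼ)_* yⱼ` pairs non-trivially with `c`
  have key : ∃ (j : ι) (q₀ : ℕ) (hab : q₀ + 2 * N = q + 2 * m j) (y : complexBetti (Y j) q₀),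
      cupProduct h c (complexGysin μ (hY j) hX (g j) hab y) ≠ 0 := by
    by_contra hall
    push Not at hall
    have hle : (⨆ (j : ι) (q₀ : ℕ) (hab : q₀ + 2 * N = q + 2 * m j),
        LinearMap.range (complexGysin μ (hY j) hX (g j) hab)) ≤ LinearMap.ker (cupProduct h c) := by
      refine iSup_le fun j ↦ iSup_le fun q₀ ↦ iSup_le fun hab ↦ ?_
      rintro _ ⟨y, rfl⟩
      exact LinearMap.mem_ker.mpr (hall j q₀ hab y)
    exact hca (LinearMap.mem_ker.mp (hle ha'))
  obtain ⟨j, q₀, hab, y, hy⟩ := key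
  -- projection formula: `gⱼ^* c ≠ 0`, and `gⱼ(ℂ)` factors through `Z(ℂ)`
  intro hcZ
  exact hy (cupProduct_complexGysin_eq_zero_of_map_eq_zero hμ (hY j) hX (g j) hab h
    (map_eq_zero_of_range_subset (g j) (Set.subset_iUnion (fun j ↦ Set.range (g j).left.base) j)
      hcZ) y)

/-- **The geometric half of BFNP Lemma 50 through the Gysin kernel, all large degrees**: for `X`
smooth projective over `ℂ`, `n ≥ 1`, granted `hA` and `hH`, a class `c ∈ H^{2n}(X(ℂ); ℂ)` pairing
non-trivially with some algebraic `d ∈ Nⁿ H^{2n}(X(ℂ); ℂ)` has `k₀ ≥ 1` such that for every `k ≥ k₀`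
it restricts non-trivially to some hypersurface section `e⁻¹ V₊(F) ≠ X` with `deg F = k`
(`forall_le_exists_sectionRestriction_ne_zero_of_supportCriterion` with the criterion
`map_ne_zero_of_cupProduct_ne_zero_of_gysinKernel`). [cite: BrosnanFangNiePearlstein2009, §6 Lemma 50 and Lemma 49] -/
theorem forall_le_exists_sectionRestriction_ne_zero_of_gysinKernel
    (hA : Deligne1974_ker_restrictCompl_eq_iSup_range_complexGysin)
    (hH : Resolution.Hironaka1964_projective.{0}) {N n : ℕ} (hn : 0 < n)
    (hX : Motives.IsSmoothProjective N X) (e : Motives.ProjectiveEmbedding X)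
    {c d : complexBetti X (2 * n)} (hd : d ∈ algebraicClasses X n)
    (hcd : cupProduct (rfl : 2 * n + 2 * n = 2 * n + 2 * n) c d ≠ 0) :
    ∃ k₀ : ℕ, 0 < k₀ ∧ ∀ k : ℕ, k₀ ≤ k →
      ∃ (F : MvPolynomial (Fin (e.n + 1)) ℂ) (Z : Set X.left), F.IsHomogeneous k ∧
        Z = e.ι.left.base ⁻¹' (letI := MvPolynomial.gradedAlgebra (σ := Fin (e.n + 1)) (R := ℂ);
          ProjectiveSpectrum.zeroLocus (MvPolynomial.homogeneousSubmodule (Fin (e.n + 1)) ℂ) {F}) ∧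
        Z ≠ Set.univ ∧
        singularCohomology.map ℂ ℂ
          (⟨Subtype.val, continuous_subtype_val⟩ :
            C({P : Motives.ComplexPoints X // P.pt ∈ Z}, Motives.ComplexPoints X)) (2 * n) c ≠ 0 :=
  forall_le_exists_sectionRestriction_ne_zero_of_supportCriterion hn hX
    (fun _ hZ _ _ ha hca ↦ map_ne_zero_of_cupProduct_ne_zero_of_gysinKernel hA hH hX hZ rfl ha hca)
    e hd hcd

/-- **BFNP Lemma 50 for one `2n`-fold through the Gysin kernel, in the strength used by
Theorem 51**: granted (P) for `X`, the Hodge conjecture for `X`, `hA` and `hH`, every non-zero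
rational `(n, n)`-class `c` has `k₀ ≥ 1` such that for every `k ≥ k₀` it restricts non-trivially
to some hypersurface section `e⁻¹ V₊(F) ≠ X` with `deg F = k` ("there exists an integer `N` such
that, for every `m ≥ N`, there exists `p ∈ |𝓛^m|` such that `ζ|_{𝒳_p} ≠ 0`").
[cite: BrosnanFangNiePearlstein2009, §6 Lemma 50 and proof of Thm. 51] -/
theorem forall_le_exists_sectionRestriction_ne_zero_of_pairing_of_gysinKernel
    (hA : Deligne1974_ker_restrictCompl_eq_iSup_range_complexGysin)
    (hH : Resolution.Hironaka1964_projective.{0}) {n : ℕ} (hn : 0 < n)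
    (hX : Motives.IsSmoothProjective (2 * n) X) (hHC : HodgeConjectureFor (2 * n) X)
    (hPair : ∀ c : complexBetti X (2 * n), IsRationalClass c →
      IsOfHodgeType (2 * n) X (2 * n) n n c → c ≠ 0 →
        ∃ a : complexBetti X (2 * n), IsRationalClass a ∧ IsOfHodgeType (2 * n) X (2 * n) n n a ∧
          cupProduct (rfl : 2 * n + 2 * n = 2 * n + 2 * n) c a ≠ 0)
    (e : Motives.ProjectiveEmbedding X) (c : complexBetti X (2 * n)) (hc : IsRationalClass c)
    (hHt : IsOfHodgeType (2 * n) X (2 * n) n n c) (hne : c ≠ 0) :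
    ∃ k₀ : ℕ, 0 < k₀ ∧ ∀ k : ℕ, k₀ ≤ k →
      ∃ (F : MvPolynomial (Fin (e.n + 1)) ℂ) (Z : Set X.left), F.IsHomogeneous k ∧
        Z = e.ι.left.base ⁻¹' (letI := MvPolynomial.gradedAlgebra (σ := Fin (e.n + 1)) (R := ℂ);
          ProjectiveSpectrum.zeroLocus (MvPolynomial.homogeneousSubmodule (Fin (e.n + 1)) ℂ) {F}) ∧
        Z ≠ Set.univ ∧
        singularCohomology.map ℂ ℂ
          (⟨Subtype.val, continuous_subtype_val⟩ :
            C({P : Motives.ComplexPoints X // P.pt ∈ Z}, Motives.ComplexPoints X)) (2 * n) c ≠ 0 := by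
  -- (P): a rational `(n, n)`-class `a` with `c ∪ a ≠ 0`; (H): `a` is algebraic
  obtain ⟨a, haQ, haH, hca⟩ := hPair c hc hHt hne
  exact forall_le_exists_sectionRestriction_ne_zero_of_gysinKernel hA hH hn hX e (hHC.2 n a haQ haH)
    hca

/-- **The named fact from (P) and two named facts of the tree.** Granted (P) the non-degeneracy
of the cup-product pairing on the rational `(n, n)`-classes of every smooth projective complex
`2n`-fold, `n ≥ 1` ("By Poincaré duality and the Hodge–Riemann bilinear relations": BFNP §6, the
perfect pairing `Hdg^n X ⊗ Hdg^n X → ℚ`), Deligne's Gysin-kernel theorem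
`Deligne1974_ker_restrictCompl_eq_iSup_range_complexGysin` (Hodge III, Cor. 8.2.8) and projective
resolution of singularities `Resolution.Hironaka1964_projective` (Kollár 2007, Thm. 3.27), the
printed proof of Lemma 50 — with "`ζ ∪ [Zᵢ] ≠ 0`, equivalently `0 ≠ ζ|_{Zᵢ}`" read through the
projection formula for a resolution of `Zᵢ` — yields `hodgeSectionRestriction_of_hodgeConjectureFor`
(at `k = k₀` of `forall_le_exists_sectionRestriction_ne_zero_of_pairing_of_gysinKernel`).
[cite: BrosnanFangNiePearlstein2009, §6 Lemma 50] [cite: DeligneHodgeIII1974, Cor. 8.2.8]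
[cite: Kollar2007, Thm. 3.27] -/
theorem hodgeSectionRestriction_of_hodgeConjectureFor_of_pairing_of_gysinKernel
    (hPair : ∀ ⦃n : ℕ⦄ ⦃X : Motives.SchemeOver ℂ⦄, 0 < n → Motives.IsSmoothProjective (2 * n) X →
      ∀ c : complexBetti X (2 * n), IsRationalClass c → IsOfHodgeType (2 * n) X (2 * n) n n c →
        c ≠ 0 → ∃ a : complexBetti X (2 * n), IsRationalClass a ∧
          IsOfHodgeType (2 * n) X (2 * n) n n a ∧
          cupProduct (rfl : 2 * n + 2 * n = 2 * n + 2 * n) c a ≠ 0)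
    (hA : Deligne1974_ker_restrictCompl_eq_iSup_range_complexGysin)
    (hH : Resolution.Hironaka1964_projective.{0}) :
    hodgeSectionRestriction_of_hodgeConjectureFor := by
  intro n X hn hX hHC e c hc hHt hne
  obtain ⟨k₀, hk₀, hk⟩ := forall_le_exists_sectionRestriction_ne_zero_of_pairing_of_gysinKernel hA
    hH hn hX hHC (hPair hn hX) e c hc hHt hne
  obtain ⟨F, Z, hFk, hZ, hZu, hcZ⟩ := hk k₀ le_rfl
  exact ⟨k₀, F, Z, hk₀, hFk, hZ, hZu, hcZ⟩


/-! ### The surface case from named facts of the tree -/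

/-- **The surface case from named facts of the tree, all large degrees** (Kerr–Pearlstein 2011,
Example 43: on a surface a non-zero rational `(1,1)`-class restricts non-trivially to some curve
section). For `X` a smooth projective surface, granted the Hodge index theorem for `X`
(`hodgeIndex_surface X`) and Lefschetz `(1,1)` (`lefschetzOneOne_rational`) — which give a divisor
class `d` with `c ∪ d ≠ 0` (`exists_cup_ne_zero_of_hodgeIndex`: (P) and (H) for `n = 1` at once)
— together with `hA` (Deligne, Cor. 8.2.8) and `hH` (resolution; for the curves `Zᵢ` this is
normalisation), every non-zero rational `(1,1)`-class `c ∈ H²(X(ℂ); ℂ)` has `k₀ ≥ 1` such that for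
every `k ≥ k₀` it restricts non-trivially to some curve section `e⁻¹ V₊(F) ≠ X` with `deg F = k`
(the landing pad `…HeightMassDefect.SectionRestrictionSurface` for `X`, in every large degree).
[cite: KerrPearlstein2011, Example 43] [cite: BrosnanFangNiePearlstein2009, §6 Lemma 50] -/
theorem forall_le_sectionRestriction_surface_of_hodgeIndex_of_gysinKernel
    (hHI : hodgeIndex_surface X) (hL : lefschetzOneOne_rational)
    (hA : Deligne1974_ker_restrictCompl_eq_iSup_range_complexGysin)
    (hH : Resolution.Hironaka1964_projective.{0}) (hX : Motives.IsSmoothProjective 2 X)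
    (e : Motives.ProjectiveEmbedding X) (c : complexBetti X 2) (hc : IsRationalClass c)
    (h11 : IsOfHodgeType 2 X 2 1 1 c) (hne : c ≠ 0) :
    ∃ k₀ : ℕ, 0 < k₀ ∧ ∀ k : ℕ, k₀ ≤ k →
      ∃ (F : MvPolynomial (Fin (e.n + 1)) ℂ) (Z : Set X.left), F.IsHomogeneous k ∧
        Z = e.ι.left.base ⁻¹' (letI := MvPolynomial.gradedAlgebra (σ := Fin (e.n + 1)) (R := ℂ);
          ProjectiveSpectrum.zeroLocus (MvPolynomial.homogeneousSubmodule (Fin (e.n + 1)) ℂ) {F}) ∧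
        Z ≠ Set.univ ∧
        singularCohomology.map ℂ ℂ
          (⟨Subtype.val, continuous_subtype_val⟩ :
            C({P : Motives.ComplexPoints X // P.pt ∈ Z}, Motives.ComplexPoints X)) 2 c ≠ 0 := by
  obtain ⟨d, -, -, hdN, hcd⟩ := exists_cup_ne_zero_of_hodgeIndex hHI hL hX c hc h11 hne
  exact forall_le_exists_sectionRestriction_ne_zero_of_gysinKernel hA hH (n := 1) one_pos hX e hdN
    hcd

end HodgeTheory

end Literature.AlgebraicGeometry.HodgeTheory

end
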